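import Mathlib.Algebra.Colimit.Module
import Literature.AnabelianGeometry.AbsoluteAnabelian.AbsTopIII.KummerPU
import Literature.AnabelianGeometry.AbsoluteAnabelian.AbsTopIII.Reconstruction
import Literature.AnabelianGeometry.AbsoluteAnabelian.AbsTopII.BelyiCuspidalization
import HarnessLib

/-!
# [AbsTopIII] Thm. 1.9, steps (a) and (d): sub-DAG statements (Belyi cuspidalizations over a
# `CurveModel`; the Kummer containers `lim_{→V} H¹(Π_V, μ_Ẑ(Π_U))`)

Mochizuki, *Topics in Absolute Anabelian Geometry III*, §1, Theorem 1.9 ("The NF-portion of the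
Function Field via Belyi Cuspidalization over Sub-p-adic Fields"), manuscript pp. 36–38 (lit key
`paper:url-5493eb38cbb7`; journal pagination not held).  The printed proof is one sentence (p. 38):
"The validity of the algorithm asserted in Theorem 1.9 is immediate from the various results cited in
the statement of this algorithm."  The intermediate statements of that proof are therefore the steps
(a)–(e) of the statement; cell abc-iut, sub-DAG `plan/L4/SUBDAG-AbsTopIII-Thm19.md` (D-0068 (1)).

The typed statement of record is `Thm_1_9 (M : CurveModel)` (`Reconstruction.lean`, abc-iut-L4-t1),
whose module docstring records that steps (a)–(d) appear there "only as abstract fields".  Step (b)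
is typed in `CuspidalSynchronization.lean` / `CcnSynchronizationModel.lean` (`Thm_1_9_b`,
`Thm_1_9_b_natural`), the subgroup `P_U` of step (c) in `KummerPU.lean` (`IntrinsicKummerModel.PU`,
model-relative), the Kummer map and Prop. 1.8 in `KummerIntrinsic.lean` / `KummerPU.lean`, Prop. 1.3 of
step (e) in `LinearSystems.lean`.  THIS FILE types, relative to a model (typing policy θ of the cell,
plan/L4/ASSIGNMENTS.md §2 — comparison statements are predicates ON A MODEL; nothing asserts that a
model exists):

* step (a) over `CurveModel`: `CurveModel.cuspidalizationOfRes` (the model's `Π_U ↠ Π_X` as a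
  cuspidalization datum of [AbsTopII] Cor. 3.7), `CurveModel.RemovesNFPoints` ("obtained by removing
  [...] NF-points"), the statements `CurveModel.Thm19aShape` (RECORD ONLY: the output SHAPE of
  [AbsTopII] Cor. 3.7 (a)(b)(c) for the NF-complement opens of a Thm-1.9 input — inhabited from the
  centre-freeness of the `Π_U` alone, abc-iut RQ7 finding A21g4-F1), `CurveModel.Thm19a` (the
  FUNCTORIAL form of (a): NF-complement cuspidalizations correspond along every isomorphism of
  extensions `Π_{X₁} ⥲ Π_{X₂}`, uniquely up to geometric inner automorphisms — the shape of [AbsTopII]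
  Cor. 3.8; v2, abc-iut-L4-lead ruling 2026-08-26T01:25:53Z (3)) and `CurveModel.Thm19a_decomp` ("by
  allowing `U` to vary, we obtain [...] the collection of subgroups that arise as decomposition groups
  of NF-points");
* bookkeeping for `H¹(Π_U, M_X(Λ))` (`cyclotomeModH1`, REAL): pull-back along a homomorphism of
  extensions over `Π_X` (`cyclotomeModH1Pull`) and the change of coefficients `M_E → M_F` along a
  homomorphism of extensions `E → F` (`cyclotomeModPush`, `cyclotomeModH1Push`) — inflation /
  base-change maps needed by the direct limit of (d);
* step (d) itself — the directed system `CurveModel.NFComplementSystem`, the container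
  `lim_{→V} H¹(Π_V, M_Z)`, the Prop.-1.8 criteria and the statements `Thm19d_inj`,
  `Thm19d_functionField`, `Thm19d_constants` — is the sibling file `Thm19KummerContainer.lean` (built
  on the `H¹` bookkeeping above); steps (b)–(c) are `Thm19CuspidalDegree.lean`.

No new Prop FACT is introduced: every cited result is an existing tree declaration; the new `def … :
Prop` are the printed intermediate statements of Thm. 1.9 itself.  Steps (c) (group-theoretic reading of
`P_U` through the synchronizations of (b)) and (e) (the Prop-1.3 triple extracted from (d)) are the
sibling rows of the sub-DAG.  HONEST FRAMING: statements-first; typed ≠ proved; refereed, undisputed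
paper; nothing here bears on [IUTchIII] Cor. 3.12.
-/

noncomputable section

open CategoryTheory
open scoped Classical Pointwise

namespace Literature.AnabelianGeometry.AbsoluteAnabelian.AbsTopIII

universe u

/-! ### Step (a): Belyi cuspidalizations over a `CurveModel` -/

namespace CurveModel

variable (M : CurveModel.{u})

/-- The model's "`Π_U ↠ Π_X`" (`M.res h` for a cofinite open `U ⊆ X`) as a *cuspidalization* of
`Π_X ↠ G_k` in the sense of [AbsTopII] Cor. 3.7 ("the natural surjection `Π_{U_X} := π₁(U_X) ↠ π₁(X)`
— i.e., 'cuspidalization' of `Π`"), given the surjectivity of the `Π`-component and the bijectivity of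
the `G`-component (the content of Prop. 1.4 (i), `CurveModel.Prop_1_4_i'`, supplied as hypotheses).
[cite: MochizukiAbsTopIII2015, Thm 1.9 (a) p.37] -/
def cuspidalizationOfRes {U X : M.Curve} (h : M.IsCofiniteOpen U X)
    (hs : Function.Surjective (M.res h).arith) (hb : Function.Bijective (M.res h).gal) :
    AbsTopII.Cuspidalization (M.ext X) :=
  ⟨M.ext U, M.res h, hs, hb⟩

/-- The image in `Π_X` of the decomposition group of a cusp `c` of the cofinite open `U ⊆ X` ("the
decomposition groups of the closed points of `X` lying in the complement of `U_X` may be obtained as the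
images via `Π_{U_X} ↠ Π` of the cuspidal decomposition groups of `Π_{U_X}`", [AbsTopII] Cor. 3.7 (c),
as used in Thm. 1.9 (a)). [cite: MochizukiAbsTopIII2015, Thm 1.9 (a) p.37] -/
def cuspImage {U X : M.Curve} (h : M.IsCofiniteOpen U X) (c : (M.cusps U).Cusp) :
    Subgroup (M.ext X).arith :=
  ((M.cusps U).Dcusp c).map (M.res h).arith.toMonoidHom

/-- "`U ⊆ Y` is an open subscheme obtained by removing an arbitrary finite collection of NF-points"
(Thm. 1.9 (a) p. 37), relative to the model: every cusp of `U` maps, up to `Π_X`-conjugacy, either onto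
a cuspidal decomposition group of `X` (a cusp `U` shares with `X`) or onto the decomposition group of an
NF-point of `X` (Def. 1.7 (ii), `M.IsNFPoint`). [cite: MochizukiAbsTopIII2015, Thm 1.9 (a) p.37] -/
def RemovesNFPoints {U X : M.Curve} (h : M.IsCofiniteOpen U X) : Prop :=
  ∀ c : (M.cusps U).Cusp,
    (∃ (c' : (M.cusps X).Cusp) (g : (M.ext X).arith),
        M.cuspImage h c = MulAut.conj g • (M.cusps X).Dcusp c') ∨
      ∃ (x : M.Point X) (g : (M.ext X).arith),
        M.IsNFPoint X x ∧ M.cuspImage h c = MulAut.conj g • M.decomp X x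

/-- "the collection of subgroups that arise as decomposition groups of NF-points" of `X` (Thm. 1.9
(a) p. 37): all `Π_X`-conjugates of the decomposition groups of the NF-points of the model — the
right-hand side of the (a)-clause of `Thm_1_9`. [cite: MochizukiAbsTopIII2015, Thm 1.9 (a) p.37] -/
def nfPointDecompSet (X : M.Curve) : Set (Subgroup (M.ext X).arith) :=
  {D | ∃ (x : M.Point X) (g : (M.ext X).arith), M.IsNFPoint X x ∧ D = MulAut.conj g • M.decomp X x}

/-- The GROUP-THEORETIC side of Thm. 1.9 (a) ("by allowing `U` to vary, we obtain a 'group-theoretic'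
construction of `Π_U` equipped with the collection of subgroups that arise as decomposition groups of
NF-points"): the `Π_X`-conjugates of images of cuspidal decomposition groups of the NF-complement opens
`U ⊆ X` of the model that are NOT conjugate to a cuspidal decomposition group of `X` itself.
[cite: MochizukiAbsTopIII2015, Thm 1.9 (a) p.37] -/
def cuspidalImageSet (X : M.Curve) : Set (Subgroup (M.ext X).arith) :=
  {D | (∃ (U : M.Curve) (h : M.IsCofiniteOpen U X) (c : (M.cusps U).Cusp) (g : (M.ext X).arith),
      M.RemovesNFPoints h ∧ D = MulAut.conj g • M.cuspImage h c) ∧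
    ¬ ∃ (c' : (M.cusps X).Cusp) (g : (M.ext X).arith), D = MulAut.conj g • (M.cusps X).Dcusp c'}

/-- **Thm. 1.9 (a), OUTPUT SHAPE, relative to `M` — RECORD ONLY** ("One constructs the various
surjections `Π_U ↠ Π_Y` — where `Y` is a hyperbolic [NF-]curve that arises as a finite étale covering
of `X`; `U ⊆ Y` is an open subscheme obtained by removing an arbitrary finite collection of NF-points
[...] — via the technique of 'Belyi cuspidalization', as described in [Mzk21], Corollary 3.7, (a), (b),
(c)", p. 37): for a Thm-1.9 input `X` of the model, scheme-like, and every cofinite open `U ⊆ X`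
removing NF-points only, with `Π_U ↠ Π_X` surjective / bijective on `G_k`, some output of the Cor.-3.7
shape (`AbsTopII.BelyiCuspidalization (Π_X ↠ G_k)`) is isomorphic over `Π_X` to `Π_U ↠ Π_X` and has the
same removed-point decomposition groups (shape of `AbsTopII.BelyiCurveModel.Cor_3_7`, here over
`CurveModel`).  HONEST SCOPE (abc-iut RQ7 finding A21g4-F1, kernel witness
`staging/L4/abc-iut-L6-t21/A21g4_Thm19aVacuityProbe.lean`, sha16 `4a520d0b6a38360f`): as long as the
`Π`-chain of [AbsTopII] Cor. 3.7 (a) is recorded by its type-chain only, this statement carries the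
SHAPE of the output and the centre-freeness behind Cor. 3.7 (b), NOT the group-theoreticity of (a) — it
is inhabited from `Subgroup.center Π_U = ⊥` alone (the model's own `Π_U ↠ Π_X` with `V := X` is a
witness); the contentful statement of (a) is `Thm19a` below.  Kept as a record (v1 name: `Thm19a`).
-- TODO(general form): the intermediate finite étale covering `Y → X` of the text (`CurveModel` has no
-- covering relation; typed for `Y = X`, as `Thm_1_9_b` is).
[cite: MochizukiAbsTopIII2015, Thm 1.9 (a) p.37] -/
def Thm19aShape (M : CurveModel.{u}) : Prop :=
  ∀ (U X : M.Curve) (h : M.IsCofiniteOpen U X), M.IsThm19Input X → M.IsScheme U → M.IsScheme X →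
    M.RemovesNFPoints h →
      ∀ (hs : Function.Surjective (M.res h).arith) (hb : Function.Bijective (M.res h).gal),
        ∃ B : AbsTopII.BelyiCuspidalization (M.ext X),
          B.cusp.IsoOver (M.cuspidalizationOfRes h hs hb) ∧
            B.cusp.decompositionImages B.cusps =
              (M.cuspidalizationOfRes h hs hb).decompositionImages (M.cusps U)

/-- **Thm. 1.9 (a), FUNCTORIAL form, relative to `M`** ("there exists a functorial 'group-theoretic'
algorithm [...] (a) One constructs the various surjections `Π_U ↠ Π_Y` [...] — via the technique of
'Belyi cuspidalization', as described in [Mzk21], Corollary 3.7, (a), (b), (c)", p. 37; "the asserted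
'functoriality' is with respect to arbitrary open injective homomorphisms of extensions of profinite
groups", p. 38): for Thm-1.9 inputs `X₁`, `X₂` of the model (strictly Belyi type over sub-`p`-adic
fields, scheme-like) and an ISOMORPHISM of extensions `φ : (Π_{X₁} ↠ G_{k₁}) ⥲ (Π_{X₂} ↠ G_{k₂})`, every
NF-complement cuspidalization `Π_{U₁} ↠ Π_{X₁}` (`U₁ ⊆ X₁` cofinite open, scheme-like, removing
NF-points only) corresponds to an NF-complement cuspidalization `Π_{U₂} ↠ Π_{X₂}` through an isomorphism
of extensions `φ_U : Π_{U₁} ⥲ Π_{U₂}` compatible with `φ` over the surjections, and such a `φ_U` is unique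
up to composition with an inner automorphism from the kernel of `Π_{U₂} ↠ Π_{X₂}` — the bi-anabelian
shape of [AbsTopII] Cor. 3.8 restricted to NF-complement opens (TRUE at the intended model by [AbsTopII]
Cor. 3.8 with Rmk. 3.7.1; NOT inhabited from centre-freeness: `φ` ranges over all isomorphisms of
extensions).  NAMED statement relative to `M` (v2 of this decl, abc-iut-L4-lead ruling 2026-08-26T01:25:53Z
(3); body = abc-iut RQ7 suggestion `A21g4_Thm19aFunctorialShape.lean`, sha16 `279bd9feaa36b241`).
-- TODO(general form): open injective homomorphisms of extensions (finite étale coverings `Y → X`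
-- over finite extensions of the base field), which is the full printed functoriality.
[cite: MochizukiAbsTopIII2015, Thm 1.9 (a) p.37] -/
def Thm19a (M : CurveModel.{u}) : Prop :=
  ∀ (X₁ X₂ : M.Curve), M.IsThm19Input X₁ → M.IsThm19Input X₂ → M.IsScheme X₁ → M.IsScheme X₂ →
    ∀ (φ : M.ext X₁ ≅ M.ext X₂) (U₁ : M.Curve) (h₁ : M.IsCofiniteOpen U₁ X₁),
      M.IsScheme U₁ → M.RemovesNFPoints h₁ →
      ∃ (U₂ : M.Curve) (h₂ : M.IsCofiniteOpen U₂ X₂),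
        M.IsScheme U₂ ∧ M.RemovesNFPoints h₂ ∧
        (∃ φU : M.ext U₁ ≅ M.ext U₂, φU.hom ≫ M.res h₂ = M.res h₁ ≫ φ.hom) ∧
        ∀ φU φU' : M.ext U₁ ≅ M.ext U₂,
          φU.hom ≫ M.res h₂ = M.res h₁ ≫ φ.hom → φU'.hom ≫ M.res h₂ = M.res h₁ ≫ φ.hom →
            ∃ g : (M.ext U₂).arith, (M.res h₂).arith g = 1 ∧
              ∀ x, φU'.hom.arith x = g * φU.hom.arith x * g⁻¹

/-- **Thm. 1.9 (a), the decomposition groups of NF-points, relative to `M`** ("by allowing `U` to vary,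
we obtain a 'group-theoretic' construction of `Π_U` equipped with the collection of subgroups that arise
as decomposition groups of NF-points", p. 37): for a scheme-like Thm-1.9 input `X`, the conjugates of
decomposition groups of NF-points of `X` are exactly the conjugates of images of cuspidal decomposition
groups of NF-complement opens `U ⊆ X` that do not come from cusps of `X` (the inclusion `⊆` is the
clause "removing an ARBITRARY finite collection of NF-points": every NF-point is removed by some `U` of
the model).  NAMED statement relative to `M`. [cite: MochizukiAbsTopIII2015, Thm 1.9 (a) p.37] -/
def Thm19a_decomp (M : CurveModel.{u}) : Prop :=
  ∀ X : M.Curve, M.IsThm19Input X → M.IsScheme X → M.nfPointDecompSet X = M.cuspidalImageSet X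

end CurveModel

/-! ### Bookkeeping for `H¹(Π_U, M_X(Λ))`: pull-back in the group, change of coefficients -/

section H1Maps

variable {E'' E' E F : FundamentalExtension.{u}} (Λ : Type u) [AddCommGroup Λ] [TopologicalSpace Λ]
  [IsTopologicalAddGroup Λ]

/-- For homomorphisms of extensions `φ : Π_{V'} → Π_V`, `r : Π_V → Π_X` with composite `r'`, the
identity of `M_X(Λ)` as a morphism from the restriction along `φ` of the `Π_V`-module `M_X(Λ)` to the
`Π_{V'}`-module `M_X(Λ)` (both act through `Π_X`). [cite: MochizukiAbsTopIII2015, Thm 1.9 (d) p.37] -/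
def cyclotomeResCompHom (φ : E'' ⟶ E') (r : E' ⟶ E) (r' : E'' ⟶ E) (hr : φ ≫ r = r') :
    TopRep.res (φ.arith : E''.arith →* E'.arith)
        (TopRep.res (r.arith : E'.arith →* E.arith) (cyclotomeModTopRep E Λ)) ⟶
      TopRep.res (r'.arith : E''.arith →* E.arith) (cyclotomeModTopRep E Λ) :=
  TopRep.ofHom
    { toContinuousLinearMap := ContinuousLinearMap.id ℤ (CyclotomeMod E Λ)
      isIntertwining' := fun g => by
        subst hr
        rfl }

/-- **Pull-back `H¹(Π_V, M_X(Λ)) → H¹(Π_{V'}, M_X(Λ))`** along a homomorphism of extensions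
`φ : Π_{V'} → Π_V` over `Π_X` (`φ ≫ r = r'`): the arrows of the direct system
"`lim_{→V} H¹(Π_V, μ_Ẑ(Π_U))`" of Thm. 1.9 (d) (inflation along `Π_V ↠ Π_{V'}`-type quotients and
restriction along base-change inclusions alike). [cite: MochizukiAbsTopIII2015, Thm 1.9 (d) p.37] -/
def cyclotomeModH1Pull (φ : E'' ⟶ E') (r : E' ⟶ E) (r' : E'' ⟶ E) (hr : φ ≫ r = r') :
    cyclotomeModH1 r Λ ⟶ cyclotomeModH1 r' Λ :=
  ContinuousCohomology.map φ.arith (cyclotomeResCompHom Λ φ r r' hr) 1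

/-- A homomorphism of extensions `f : E → F` restricted to the geometric parts, `Δ_E → Δ_F`
(`Hom.mapsTo_geom`), as a continuous homomorphism. [cite: MochizukiAbsTopIII2015, Thm 1.9 p.38] -/
def geomHom (f : E ⟶ F) : E.geom →ₜ* F.geom where
  toFun x := ⟨f.arith x, f.mapsTo_geom x.2⟩
  map_one' := Subtype.ext (map_one _)
  map_mul' _ _ := Subtype.ext (map_mul _ _ _)
  continuous_toFun := (f.arith.continuous.comp continuous_subtype_val).subtype_mk _

/-- Value of `geomHom`. [cite: MochizukiAbsTopIII2015, Thm 1.9 p.38] -/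
@[simp] theorem coe_geomHom_apply (f : E ⟶ F) (x : E.geom) : (geomHom f x : F.arith) = f.arith x :=
  rfl

/-- The identity of `Λ` as a morphism from the restriction along `Δ_E → Δ_F` of the trivial
`Δ_F`-module `Λ` to the trivial `Δ_E`-module `Λ`. [cite: MochizukiAbsTopIII2015, Thm 1.9 p.38] -/
def geomTrivialHomRes (f : E ⟶ F) :
    TopRep.res (geomHom f : E.geom →* F.geom) (geomTrivialRep F Λ) ⟶ geomTrivialRep E Λ :=
  TopRep.ofHom
    { toContinuousLinearMap := ContinuousLinearMap.id ℤ Λ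
      isIntertwining' := fun _ => by
        ext v
        rfl }

/-- **`H²(f|_Δ) : H²(Δ_F, Λ) → H²(Δ_E, Λ)`**, the pull-back on continuous cohomology along the geometric
part of a homomorphism of extensions (for a base-change homomorphism, `Δ_E ⥲ Δ_F`, this is the
identification behind "`μ_Ẑ(Π_U) := M_Z`" being insensitive to `Z ×_{k_Z} k′`, Thm. 1.9 (b), (d)).
[cite: MochizukiAbsTopIII2015, Thm 1.9 (d) p.37] -/
def geomH2Pull (f : E ⟶ F) : geomH2 F Λ ⟶ geomH2 E Λ :=
  ContinuousCohomology.map (geomHom f) (geomTrivialHomRes Λ f) 2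

/-- Change of coefficients on `Hom(H²(Δ_E, Λ), Λ) → Hom(H²(Δ_F, Λ), Λ)` along `f : E → F`:
`m ↦ m ∘ H²(f|_Δ)` (as a `ℤ`-linear map). [cite: MochizukiAbsTopIII2015, Thm 1.9 (d) p.37] -/
def geomCyclotomeDualPush (f : E ⟶ F) : geomCyclotomeDual E Λ →ₗ[ℤ] geomCyclotomeDual F Λ where
  toFun m := m.comp (geomH2Pull Λ f).hom.toLinearMap
  map_add' m m' := by
    ext ξ
    rfl
  map_smul' c m := by
    ext ξ
    rfl

/-- Formula for `geomCyclotomeDualPush`. [cite: MochizukiAbsTopIII2015, Thm 1.9 (d) p.37] -/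
@[simp] theorem geomCyclotomeDualPush_apply (f : E ⟶ F) (m : geomCyclotomeDual E Λ) (ξ : geomH2 F Λ) :
    geomCyclotomeDualPush Λ f m ξ = m ((geomH2Pull Λ f).hom ξ) :=
  rfl

/-- **Change of coefficients `M_E(Λ) → M_F(Λ)`** along a homomorphism of extensions `f : E → F`:
`m ↦ m ∘ H²(f|_Δ)` on `M_E(Λ) = Hom(H²(Δ_E, Λ), Λ)`, continuous for the topologies of pointwise
convergence. [cite: MochizukiAbsTopIII2015, Thm 1.9 (d) p.37] -/
def cyclotomeModPush (f : E ⟶ F) : CyclotomeMod E Λ →L[ℤ] CyclotomeMod F Λ where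
  toFun m := CyclotomeMod.ofDual (geomCyclotomeDualPush Λ f m.toDual)
  map_add' m m' := map_add (geomCyclotomeDualPush Λ f) m.toDual m'.toDual
  map_smul' c m := by
    change geomCyclotomeDualPush Λ f (c • m.toDual) = c • geomCyclotomeDualPush Λ f m.toDual
    exact map_zsmul _ c _
  cont := by
    refine continuous_induced_rng.2 (continuous_pi fun ξ => ?_)
    exact CyclotomeMod.continuous_eval ((geomH2Pull Λ f).hom ξ)

/-- Formula for `cyclotomeModPush`. [cite: MochizukiAbsTopIII2015, Thm 1.9 (d) p.37] -/
@[simp] theorem cyclotomeModPush_toDual (f : E ⟶ F) (m : CyclotomeMod E Λ) :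
    (cyclotomeModPush Λ f m).toDual = geomCyclotomeDualPush Λ f m.toDual :=
  rfl

/-- The geometric parts commute with conjugation: `f|_Δ ∘ c_a = c_{f(a)} ∘ f|_Δ` on `Δ_E`.
[cite: MochizukiAbsTopIII2015, Thm 1.9 (d) p.37] -/
theorem geomHom_comp_geomConj (f : E ⟶ F) (a : E.arith) :
    (geomHom f).comp (geomConj E a) = (geomConj F (f.arith a)).comp (geomHom f) := by
  refine ContinuousMonoidHom.ext fun x => Subtype.ext ?_
  change f.arith (a * (x : E.arith) * a⁻¹) = f.arith a * f.arith (x : E.arith) * (f.arith a)⁻¹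
  rw [map_mul, map_mul, map_inv]

/-- `H²(f|_Δ)` intertwines the conjugation actions: `H²(f|_Δ) ≫ H²(c_a) = H²(c_{f(a)}) ≫ H²(f|_Δ)`
(functoriality of continuous `H²` in the group). [cite: MochizukiAbsTopIII2015, Thm 1.9 (d) p.37] -/
theorem geomH2Pull_comp_geomH2Map (f : E ⟶ F) (a : E.arith) :
    geomH2Pull Λ f ≫ geomH2Map E Λ a = geomH2Map F Λ (f.arith a) ≫ geomH2Pull Λ f := by
  have h1 : geomH2Pull Λ f ≫ geomH2Map E Λ a =
      ContinuousCohomology.map ((geomHom f).comp (geomConj E a))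
        ((TopRep.resFunctor (geomConj E a : E.geom →* E.geom)).map (geomTrivialHomRes Λ f) ≫
          geomTrivialResHom E Λ a) 2 :=
    (ContinuousCohomology.map_comp _ _ _ _ 2).symm
  have h2 : geomH2Map F Λ (f.arith a) ≫ geomH2Pull Λ f =
      ContinuousCohomology.map ((geomConj F (f.arith a)).comp (geomHom f))
        ((TopRep.resFunctor (geomHom f : E.geom →* F.geom)).map (geomTrivialResHom F Λ (f.arith a)) ≫
          geomTrivialHomRes Λ f) 2 :=
    (ContinuousCohomology.map_comp _ _ _ _ 2).symm
  rw [h1, h2]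
  exact contCohomologyMap_congr (geomHom_comp_geomConj f a) _ _ rfl 2

/-- **Equivariance of the change of coefficients**: `cyclotomeModPush f (a · m) = f(a) · cyclotomeModPush f m`
for `a ∈ Π_E` (the `Π`-actions on `M_E(Λ)`, `M_F(Λ)` by `H²` of conjugation).
[cite: MochizukiAbsTopIII2015, Thm 1.9 (d) p.37] -/
theorem cyclotomeModPush_act (f : E ⟶ F) (a : E.arith) (m : CyclotomeMod E Λ) :
    cyclotomeModPush Λ f (cyclotomeModRep E Λ a m) =
      cyclotomeModRep F Λ (f.arith a) (cyclotomeModPush Λ f m) := by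
  change CyclotomeMod.ofDual (geomCyclotomeDualPush Λ f (CyclotomeMod.act E Λ a m).toDual) =
    CyclotomeMod.act F Λ (f.arith a) (CyclotomeMod.ofDual (geomCyclotomeDualPush Λ f m.toDual))
  apply congrArg CyclotomeMod.ofDual
  refine LinearMap.ext fun ξ => ?_
  change m.toDual ((geomH2Pull Λ f ≫ geomH2Map E Λ a).hom ξ) =
    m.toDual ((geomH2Map F Λ (f.arith a) ≫ geomH2Pull Λ f).hom ξ)
  rw [geomH2Pull_comp_geomH2Map]

/-- The change of coefficients as a morphism of restricted representations: from the `Π_V`-module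
`M_E(Λ)` (through `r : Π_V → Π_E`) to the `Π_V`-module `M_F(Λ)` (through `r ≫ f`).
[cite: MochizukiAbsTopIII2015, Thm 1.9 (d) p.37] -/
def cyclotomePushResHom (r : E' ⟶ E) (f : E ⟶ F) :
    TopRep.res ((ContinuousMonoidHom.id E'.arith : E'.arith →ₜ* E'.arith) : E'.arith →* E'.arith)
        (TopRep.res (r.arith : E'.arith →* E.arith) (cyclotomeModTopRep E Λ)) ⟶
      TopRep.res ((r ≫ f).arith : E'.arith →* F.arith) (cyclotomeModTopRep F Λ) :=
  TopRep.ofHom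
    { toContinuousLinearMap := cyclotomeModPush Λ f
      isIntertwining' := fun g => by
        ext m
        exact cyclotomeModPush_act Λ f (r.arith g) m }

/-- **Change of coefficients on `H¹`**: `H¹(Π_V, M_E(Λ)) → H¹(Π_V, M_F(Λ))` along `f : E → F` (for a
base-change homomorphism `Π_{Z ×_{k_Z} k′} → Π_Z` this is the identification `μ_Ẑ(Π_U) = M_Z` of the
coefficients of "`lim_{→V} H¹(Π_V, μ_Ẑ(Π_U))`", Thm. 1.9 (d)). [cite: MochizukiAbsTopIII2015, Thm 1.9 (d) p.37] -/
def cyclotomeModH1Push (r : E' ⟶ E) (f : E ⟶ F) : cyclotomeModH1 r Λ ⟶ cyclotomeModH1 (r ≫ f) Λ :=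
  ContinuousCohomology.map (ContinuousMonoidHom.id E'.arith) (cyclotomePushResHom Λ r f) 1

end H1Maps

end Literature.AnabelianGeometry.AbsoluteAnabelian.AbsTopIII
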